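import Mathlib
import Literature.Analysis.ODE.RecursiveSeries
import Literature.NumberTheory.LFunctions.RieszMeanInvDedekindZeta
import Literature.NumberTheory.LFunctions.DegreeOnePrimes
import Literature.NumberTheory.LFunctions.DegreeOnePrimesPNT
import Literature.NumberTheory.LFunctions.HallTenenbaumTheorem01
import Literature.NumberTheory.LFunctions.DedekindZetaVonMangoldt
import Literature.NumberTheory.LFunctions.SiegelWalfiszMoebius
import Literature.NumberTheory.LFunctions.MoebiusLogHarmonicSum
import Literature.NumberTheory.LFunctions.RudnickSarnakNExchange
import Literature.NumberTheory.Sieve.BatemanHornProofs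
import Literature.NumberTheory.Sieve.BatemanHornLocalCounts
import Literature.NumberTheory.Sieve.PolynomialCongruencesLemmas
import Literature.NumberTheory.Sieve.PolynomialCongruencesProofs
import Literature.NumberTheory.Sieve.PolynomialCongruencesMeanValues
import Literature.NumberTheory.Sieve.PolynomialValuesSieveSequence
import Literature.NumberTheory.Sieve.SieveFrameworkProofs
import Literature.NumberTheory.Sieve.ShiuTheoremProofs
import Literature.NumberTheory.Sieve.AsymptoticSieveForPrimesHolds
import Literature.NumberTheory.Sieve.FriedlanderIwaniecPrimesSquarefreeProofs
import Literature.NumberTheory.Sieve.DivisorPowerSums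
import Summits.Parity.BatemanHorn.Theorems.IsogenyRedeiDefs
import HarnessLib

/-!
# Type-I main term for Bateman–Horn (stmt-Parity-0873), input A1 (part 1):
# the Dirichlet series `∑ μ(n)ρ_f(n) n^{-s} = H(s)/ζ_K(s)`

Helper file for `Summits/Parity/BatemanHorn/Theorems/IsogenyRedeiTypeIMainTerm*.lean`
(item stmt-Parity-0873, `TypeIMainTerm` of route IsogenyRedei). For `f ∈ ℤ[X]` with root counts
`ρ_f(n) = #{ν mod n : f(ν) ≡ 0}` (`polyRootCountMod ![f] n`) and a number field `K` we set up

* `moebRho f` — the multiplicative arithmetic function `a_f(n) = μ(n) ρ_f(n)`;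
* `normCount K` — `c_K(n) = #{I ⊆ 𝓞_K : N(I) = n}` as an arithmetic function, whose `L`-series is
  the Dedekind zeta function (`LSeries_normCount`);
* `numer K f = a_f ⋆ c_K` — the numerator `H`, multiplicative, with
  `H(p^e) = c_K(p^e) − ρ_f(p) c_K(p^{e−1})` (`numer_prime_pow`);
* `LSeriesSummable_and_tsum_norm_le_of_isMultiplicative` — the Euler-product majorant
  `∑ ‖g(n)‖ n^{-σ} ≤ exp(∑_p u_p)` for a multiplicative `g` whose local series are `≤ 1 + u_p`
  (Hall–Tenenbaum (0.4), the tree's `HallTenenbaum.sum_div_le_prod_tsum`);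
* `LSeriesSummable_moebRho` — `∑ μ(n)ρ_f(n) n^{-σ}` converges absolutely for `σ > 1` once
  `ρ_f(p) ≤ B` at all primes.

Part 2 (`…RieszBound.lean`) bounds `H` on `Re s = 3/4` via Dedekind–Kummer and applies the tree's
`NumberField.logRieszMean_LSeries_div_dedekindZeta_bound`. Everything here is proved.
-/

noncomputable section

open Filter Finset Polynomial ArithmeticFunction Complex
open scoped ArithmeticFunction.Moebius ArithmeticFunction.omega Topology

namespace Summit.Parity.BatemanHorn.Theorems.TypeIMainTerm

open Literature.NumberTheory.Sieve Literature.NumberTheory.LFunctions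

/-! ### The arithmetic functions `a_f = μ ρ_f` and `c_K` -/

/-- `a_f` is multiplicative (`μ` and `ρ_f` are). -/
theorem isMultiplicative_moebRho (f : ℤ[X]) : (moebRho f).IsMultiplicative := by
  refine ⟨by simp [moebRho_apply, polyRootCountMod_one], fun {m n} hmn => ?_⟩
  simp only [moebRho_apply]
  rw [ArithmeticFunction.isMultiplicative_moebius.map_mul_of_coprime hmn,
    polyRootCountMod_mul_of_coprime f hmn]
  push_cast
  ring

/-- `a_f(p^j) = 0` for `j ≥ 2`. -/
theorem moebRho_prime_pow_eq_zero (f : ℤ[X]) {p : ℕ} (hp : p.Prime) {j : ℕ} (hj : 2 ≤ j) :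
    moebRho f (p ^ j) = 0 := by
  rw [moebRho_apply, ArithmeticFunction.moebius_apply_prime_pow hp (by omega)]
  simp [show j ≠ 1 by omega]

/-- `a_f(p) = -ρ_f(p)`. -/
theorem moebRho_prime (f : ℤ[X]) {p : ℕ} (hp : p.Prime) :
    moebRho f p = -(polyRootCountMod ![f] p : ℂ) := by
  rw [moebRho_apply, ArithmeticFunction.moebius_apply_prime hp]
  simp

/-- `‖a_f(n)‖ ≤ ρ_f(n)`. -/
theorem norm_moebRho_le (f : ℤ[X]) (n : ℕ) : ‖moebRho f n‖ ≤ polyRootCountMod ![f] n := by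
  rw [moebRho_apply, norm_mul, Complex.norm_intCast, Complex.norm_natCast]
  have h1 : |(μ n : ℝ)| ≤ 1 := by exact_mod_cast ArithmeticFunction.abs_moebius_le_one
  calc |(μ n : ℝ)| * (polyRootCountMod ![f] n : ℝ) ≤ 1 * polyRootCountMod ![f] n :=
        mul_le_mul_of_nonneg_right h1 (Nat.cast_nonneg _)
    _ = _ := one_mul _

variable (K : Type*) [Field K] [NumberField K]

/-- `c_K` is multiplicative. -/
theorem isMultiplicative_normCount : (normCount K).IsMultiplicative := by
  refine ⟨by rw [normCount_apply K one_ne_zero, idealNormCount_one]; simp, fun {m n} hmn => ?_⟩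
  rcases Nat.eq_zero_or_pos m with rfl | hm
  · simp
  rcases Nat.eq_zero_or_pos n with rfl | hn
  · simp
  rw [normCount_apply K (Nat.mul_ne_zero hm.ne' hn.ne'), normCount_apply K hm.ne',
    normCount_apply K hn.ne', idealNormCount_mul_of_coprime K hmn]
  push_cast
  ring

/-- The `L`-series of `c_K` is the Dedekind zeta function. -/
theorem LSeries_normCount (s : ℂ) :
    LSeries (fun n => normCount K n) s = NumberField.dedekindZeta K s := by
  rw [dedekindZeta_eq_LSeries]
  exact LSeries_congr (fun {n} hn => by rw [normCount_apply K hn]) s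

/-- `L(c_K, s)` converges absolutely for `Re s > 1`. -/
theorem LSeriesSummable_normCount {s : ℂ} (hs : 1 < s.re) :
    LSeriesSummable (fun n => normCount K n) s :=
  (LSeriesSummable_congr s (fun {n} hn => by rw [normCount_apply K hn])).mpr
    (NumberField.LSeriesSummable_idealNormCount K hs)

/-! ### The numerator `H = a_f ⋆ c_K` -/

/-- `H` is multiplicative. -/
theorem isMultiplicative_numer (f : ℤ[X]) : (numer K f).IsMultiplicative :=
  (isMultiplicative_moebRho f).mul (isMultiplicative_normCount K)

/-- Local values: `H(p^e) = c_K(p^e) − ρ_f(p) c_K(p^{e-1})` for `e ≥ 1`. -/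
theorem numer_prime_pow (f : ℤ[X]) {p : ℕ} (hp : p.Prime) {e : ℕ} (he : 1 ≤ e) :
    numer K f (p ^ e) =
      (idealNormCount K (p ^ e) : ℂ) - (polyRootCountMod ![f] p : ℂ) * idealNormCount K (p ^ (e - 1)) := by
  rw [numer, mul_apply, ← Nat.map_div_right_divisors, Finset.sum_map, Nat.divisors_prime_pow hp,
    Finset.sum_map]
  simp only [Function.Embedding.coeFn_mk]
  -- only `i = 0, 1` survive
  have hsplit : ∑ i ∈ Finset.range (e + 1), moebRho f (p ^ i) * normCount K (p ^ e / p ^ i) =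
      ∑ i ∈ Finset.range 2, moebRho f (p ^ i) * normCount K (p ^ e / p ^ i) := by
    symm
    refine Finset.sum_subset (Finset.range_subset_range.mpr (by omega)) fun i hi hi2 => ?_
    rw [Finset.mem_range, not_lt] at hi2
    rw [moebRho_prime_pow_eq_zero f hp hi2, zero_mul]
  rw [hsplit, Finset.sum_range_succ, Finset.sum_range_one, pow_zero, Nat.div_one,
    Nat.pow_div he hp.pos, pow_one,
    (isMultiplicative_moebRho f).map_one, one_mul, moebRho_prime f hp,
    normCount_apply K (pow_ne_zero _ hp.ne_zero),
    normCount_apply K (pow_ne_zero _ hp.ne_zero)]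
  ring


/-! ### Euler-product majorant for the absolute `L`-series of a multiplicative function -/

omit [NumberField K] in
variable {K} in
/-- For a multiplicative `g : ArithmeticFunction ℂ` and real `σ`: if every local series
`∑_ν ‖g(p^ν)‖ p^{-νσ}` converges with sum `≤ 1 + u_p`, `u_p ≥ 0`, and `∑_{p ≤ X} u_p ≤ L` for all
`X`, then `L(g, σ)` converges absolutely and `∑_n ‖g(n)‖ n^{-σ} ≤ exp L`
(Hall–Tenenbaum (0.4), `∑_{n ≤ X} F(n)/n ≤ ∏_{p ≤ X} ∑_ν F(p^ν)/p^ν` with `F(n) = ‖g(n)‖ n^{1-σ}`). -/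
theorem LSeriesSummable_and_tsum_norm_le_of_isMultiplicative {g : ArithmeticFunction ℂ}
    (hg : g.IsMultiplicative) (σ : ℝ) (u : ℕ → ℝ) (L : ℝ)
    (hloc : ∀ p : ℕ, p.Prime →
      Summable (fun ν : ℕ => ‖g (p ^ ν)‖ * ((p : ℝ) ^ (-σ)) ^ ν) ∧
        ∑' ν : ℕ, ‖g (p ^ ν)‖ * ((p : ℝ) ^ (-σ)) ^ ν ≤ 1 + u p)
    (hL : ∀ X : ℕ, ∑ p ∈ Nat.primesLE X, u p ≤ L) :
    LSeriesSummable (fun n => g n) σ ∧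
      ∑' n : ℕ, ‖LSeries.term (fun n => g n) σ n‖ ≤ Real.exp L := by
  set F : ℕ → ℝ := fun n => ‖g n‖ * (n : ℝ) ^ (1 - σ) with hF
  have hF1 : F 1 = 1 := by simp [hF, hg.map_one]
  have hFmul : ∀ m n : ℕ, m.Coprime n → F (m * n) = F m * F n := by
    intro m n hmn
    simp only [hF]
    rw [hg.map_mul_of_coprime hmn, norm_mul, Nat.cast_mul,
      Real.mul_rpow (Nat.cast_nonneg m) (Nat.cast_nonneg n)]
    ring
  have hF0 : ∀ n, 0 ≤ F n := fun n => by positivity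
  -- local factors in the form `F(p^ν)/p^ν`
  have hFloc : ∀ p : ℕ, p.Prime → ∀ ν : ℕ,
      F (p ^ ν) / (p : ℝ) ^ ν = ‖g (p ^ ν)‖ * ((p : ℝ) ^ (-σ)) ^ ν := by
    intro p hp ν
    have hp0 : (0 : ℝ) < p := by exact_mod_cast hp.pos
    simp only [hF]
    rw [Nat.cast_pow, ← Real.rpow_natCast_mul hp0.le, mul_comm (ν : ℝ) (1 - σ),
      Real.rpow_mul_natCast hp0.le, mul_div_assoc, ← div_pow,
      ← Real.rpow_sub_one hp0.ne', sub_sub_cancel_left, Real.rpow_neg hp0.le]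
  have hsumloc : ∀ p : ℕ, p.Prime → Summable (fun ν : ℕ => F (p ^ ν) / (p : ℝ) ^ ν) := by
    intro p hp
    simp_rw [hFloc p hp]
    exact (hloc p hp).1
  have hpartial : ∀ X : ℕ, ∑ n ∈ Icc 1 X, F n / n ≤ Real.exp L := by
    intro X
    refine (HallTenenbaum.sum_div_le_prod_tsum hF1 hFmul hF0 hsumloc X).trans ?_
    calc ∏ p ∈ Nat.primesLE X, ∑' ν : ℕ, F (p ^ ν) / (p : ℝ) ^ ν
        ≤ ∏ p ∈ Nat.primesLE X, Real.exp (u p) := by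
          refine Finset.prod_le_prod (fun p _ => tsum_nonneg fun ν => by positivity) fun p hp => ?_
          have hp' := Nat.prime_of_mem_primesLE hp
          simp_rw [hFloc p hp']
          exact (hloc p hp').2.trans (by linarith [Real.add_one_le_exp (u p)])
      _ = Real.exp (∑ p ∈ Nat.primesLE X, u p) := by rw [Real.exp_sum]
      _ ≤ Real.exp L := Real.exp_le_exp.mpr (hL X)
  -- `F n / n = ‖term g σ n‖`
  have hterm : ∀ n : ℕ, ‖LSeries.term (fun n => g n) σ n‖ = F n / n := by
    intro n
    rcases Nat.eq_zero_or_pos n with rfl | hn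
    · simp [hF]
    have hn0 : (0 : ℝ) < n := by exact_mod_cast hn
    rw [LSeries.norm_term_eq, if_neg hn.ne', Complex.ofReal_re]
    simp only [hF]
    rw [Real.rpow_sub hn0, Real.rpow_one]
    have hnσ : (0 : ℝ) < (n : ℝ) ^ σ := Real.rpow_pos_of_pos hn0 σ
    field_simp
  have hnn : ∀ n : ℕ, 0 ≤ ‖LSeries.term (fun n => g n) σ n‖ := fun n => norm_nonneg _
  have hrange : ∀ N : ℕ, ∑ n ∈ Finset.range N, ‖LSeries.term (fun n => g n) σ n‖ ≤ Real.exp L := by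
    intro N
    have hsub : Finset.range N ⊆ insert 0 (Icc 1 N) := by
      intro n hn
      rw [Finset.mem_insert, Finset.mem_Icc]
      rw [Finset.mem_range] at hn
      omega
    calc ∑ n ∈ Finset.range N, ‖LSeries.term (fun n => g n) σ n‖
        ≤ ∑ n ∈ insert 0 (Icc 1 N), ‖LSeries.term (fun n => g n) σ n‖ :=
          Finset.sum_le_sum_of_subset_of_nonneg hsub fun n _ _ => hnn n
      _ = ∑ n ∈ Icc 1 N, F n / n := by
          rw [Finset.sum_insert (by simp), LSeries.term_zero, norm_zero, zero_add]
          exact Finset.sum_congr rfl fun n _ => hterm n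
      _ ≤ Real.exp L := hpartial N
  have hs : Summable fun n : ℕ => ‖LSeries.term (fun n => g n) σ n‖ :=
    summable_of_sum_range_le hnn hrange
  exact ⟨hs.of_norm, Real.tsum_le_of_sum_range_le hnn hrange⟩

/-! ### Absolute convergence of `A(s) = ∑ μ(n)ρ_f(n) n^{-s}` for `Re s > 1` -/

omit [NumberField K] in
variable {K} in
/-- A finite sum of a nonnegative summable function over the primes `≤ X` is at most its sum over
all primes. -/
theorem sum_primesLE_le_tsum_primes {g : ℕ → ℝ} (hg : ∀ p : ℕ, 0 ≤ g p)
    (hs : Summable (fun p : Nat.Primes => g p)) (X : ℕ) :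
    ∑ p ∈ Nat.primesLE X, g p ≤ ∑' p : Nat.Primes, g p := by
  let emb : {p // p ∈ Nat.primesLE X} ↪ Nat.Primes :=
    ⟨fun q => ⟨q.1, (Nat.mem_primesLE.mp q.2).2⟩, fun a b hab => by
      apply Subtype.ext
      have := congrArg Subtype.val hab
      exact this⟩
  have h1 : ∑ p ∈ Nat.primesLE X, g p = ∑ q ∈ (Nat.primesLE X).attach.map emb, g (q : ℕ) := by
    rw [Finset.sum_map, ← Finset.sum_attach]
    rfl
  rw [h1]
  exact hs.sum_le_tsum _ fun q _ => hg q

/-- If `ρ_f(p) ≤ B` for all primes `p` then `L(a_f, σ)` converges absolutely for every `σ > 1`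
(local factors `1 + ρ_f(p) p^{-σ} ≤ 1 + B p^{-σ}`). -/
theorem LSeriesSummable_moebRho (f : ℤ[X]) {B : ℝ} (hB0 : 0 ≤ B)
    (hB : ∀ p : ℕ, p.Prime → (polyRootCountMod ![f] p : ℝ) ≤ B) {σ : ℝ} (hσ : 1 < σ) :
    LSeriesSummable (fun n => moebRho f n) σ := by
  have hprimes : Summable (fun p : Nat.Primes => ((p : ℕ) : ℝ) ^ (-σ)) :=
    Nat.Primes.summable_rpow.mpr (by linarith)
  set S : ℝ := ∑' p : Nat.Primes, ((p : ℕ) : ℝ) ^ (-σ) with hS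
  refine (LSeriesSummable_and_tsum_norm_le_of_isMultiplicative (isMultiplicative_moebRho f) σ
    (fun p => B * (p : ℝ) ^ (-σ)) (B * S) (fun p hp => ?_) (fun X => ?_)).1
  · -- the local series is supported on `ν ∈ {0, 1}`
    have hp0 : (0 : ℝ) < p := by exact_mod_cast hp.pos
    have hzero : ∀ ν : ℕ, ν ∉ Finset.range 2 →
        ‖moebRho f (p ^ ν)‖ * ((p : ℝ) ^ (-σ)) ^ ν = 0 := by
      intro ν hν
      rw [Finset.mem_range, not_lt] at hν
      rw [moebRho_prime_pow_eq_zero f hp hν, norm_zero, zero_mul]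
    refine ⟨summable_of_ne_finset_zero hzero, ?_⟩
    rw [tsum_eq_sum hzero, Finset.sum_range_succ, Finset.sum_range_one, pow_zero, pow_zero,
      pow_one, pow_one, (isMultiplicative_moebRho f).map_one, norm_one, one_mul, moebRho_prime f hp,
      norm_neg, Complex.norm_natCast]
    have : (0 : ℝ) ≤ (p : ℝ) ^ (-σ) := Real.rpow_nonneg hp0.le _
    nlinarith [hB p hp]
  · rw [← Finset.mul_sum]
    exact mul_le_mul_of_nonneg_left
      (sum_primesLE_le_tsum_primes (fun p => Real.rpow_nonneg (Nat.cast_nonneg p) _) hprimes X) hB0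


end Summit.Parity.BatemanHorn.Theorems.TypeIMainTerm

end
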